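import Summits.KontsevichZagierPeriods.KontsevichZagierPeriods.Theses.SymplecticScissors

/-!
# Crux `SymplecticScissors.PlanarCompiler` (stmt-KontsevichZagierPeriods-10058) — crux-ideate round 1,
ideator 2: first lemmas of three levers (signatures only — nothing in §§1–3 is proved; §3' proves the
pointwise oriented-additivity identity `chi_add` behind lever 3).

* §1 `tame-antecedent-bootstrap`  — an eval-preserving endomorphism `N` of the free group that is the
  identity on TAME 1-dimensional representations, lands in tame ones, and carries every dimension-1
  move instance to a chain of instances among tame representations: the antecedent
  `RealOnePeriodRelations` improves itself to tame intermediates before any planar geometry.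
* §2 `twist-restoring-shear` — add `λ·a·b` to the Green potential: for `λ` above minus the infimum of
  the mixed partial `∂_b A = ∂_a B` the two Lagrangian projections `(a, A + λb)`, `(b, B + λa)` are
  injective on the open triangle, so the Green generator compiles to ONE change of variables between
  two bands (no fold subdivision).
* §3 `oriented-fibre-indicators` (working name `signed-indicator-calculus`) — planar set-chains modulo rule 1a are faithfully modelled by
  ℤ-valued indicator combinations modulo null sets: a combination of planar integrand-1
  representations whose indicator sum vanishes a.e. is a sum of planar 1a instances.
-/

noncomputable section

set_option linter.dupNamespace false
set_option linter.unusedSimpArgs false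

open Set MeasureTheory
open Literature.NumberTheory.Transcendental
open Literature.NumberTheory.Transcendental.KZ

namespace Summit.KontsevichZagierPeriods.KontsevichZagierPeriods.Cruxes.PlanarCompiler.Ideator2

/-! ## §0 Shared vocabulary (abbreviations over tree declarations only) -/

/-- The planar set-chain group of the route: closure of the 1a- and rule-2 instances all of whose
terms are planar integrand-1 representations (verbatim the target subgroup of `PlanarK0Injective`). -/
def planarGroup : AddSubgroup FormalRep :=
  AddSubgroup.closure ((domainAddRel ∪ changeOfVariablesRel) ∩
    (AddSubgroup.closure {x : FormalRep | ∃ s : IntegralRep 2, (∀ p ∈ s.domain, s.integrand p = 1) ∧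
      x = of s} : Set FormalRep))

/-- Planar integrand-1 generators. -/
def planarGens : Set FormalRep :=
  {x : FormalRep | ∃ s : IntegralRep 2, (∀ p ∈ s.domain, s.integrand p = 1) ∧ x = of s}

/-- A 1-dimensional representation is TAME if its domain is bounded and its integrand is bounded on
it (so its planar cells are BOUNDED sets; the domain is automatically a finite union of intervals and
points, and smoothness is not demanded: semialgebraic functions are Nash off finitely many points,
which vertical cuts (1a) remove inside the plane; null / finite domains are tame, so the null-set
bookkeeping `−[N] = [N] − [N] − [N]` stays inside the tame world). -/
def IsTame (r : IntegralRep 1) : Prop :=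
  ∃ a b M : ℝ, r.domain ⊆ {z | z 0 ∈ Set.Icc a b} ∧ ∀ z ∈ r.domain, |r.integrand z| ≤ M

/-- Generators `[r]` of tame 1-dimensional representations. -/
def tameGens : Set FormalRep := {x | ∃ r : IntegralRep 1, IsTame r ∧ x = of r}

/-- Generators `[r]` of all 1-dimensional representations. -/
def dimOneGens : Set FormalRep := Set.range fun r : IntegralRep 1 => of r

/-- The Green generator set of the antecedent, copied verbatim from the route file. -/
def greenGens : Set FormalRep :=
  {g : FormalRep | ∃ (Δ : Set (Fin 2 → ℝ)) (A B S : (Fin 2 → ℝ) → ℝ) (r₀₁ r₁₂ r₀₂ : IntegralRep 1),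
    Δ = {p | 0 ≤ p 0 ∧ 0 ≤ p 1 ∧ p 0 + p 1 ≤ 1} ∧ IsSemialgebraicFunOn ℚ Δ A ∧
    IsSemialgebraicFunOn ℚ Δ B ∧ ContinuousOn A Δ ∧ ContinuousOn B Δ ∧
    (∀ p : Fin 2 → ℝ, 0 < p 0 → 0 < p 1 → p 0 + p 1 < 1 →
      HasFDerivAt S (A p • ContinuousLinearMap.proj (R := ℝ) (φ := fun _ : Fin 2 => ℝ) 0 +
        B p • ContinuousLinearMap.proj (R := ℝ) (φ := fun _ : Fin 2 => ℝ) 1) p) ∧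
    r₀₁.domain = {z | z 0 ∈ Set.Ioo 0 1} ∧ r₁₂.domain = {z | z 0 ∈ Set.Ioo 0 1} ∧
    r₀₂.domain = {z | z 0 ∈ Set.Ioo 0 1} ∧ (∀ z ∈ r₀₁.domain, r₀₁.integrand z = A ![z 0, 0]) ∧
    (∀ z ∈ r₁₂.domain, r₁₂.integrand z = B ![1 - z 0, z 0] - A ![1 - z 0, z 0]) ∧
    (∀ z ∈ r₀₂.domain, r₀₂.integrand z = B ![0, z 0]) ∧ g = of r₀₁ + of r₁₂ - of r₀₂}

/-- Sanity: the route's antecedent is literally "eval-zero combinations of 1-dim reps lie in the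
closure of the three move sets and `greenGens`". -/
example : Theses.SymplecticScissors.RealOnePeriodRelations =
    (∀ c : FormalRep, c ∈ AddSubgroup.closure dimOneGens → eval c = 0 →
      c ∈ AddSubgroup.closure (domainAddRel ∪ integrandAddRel ∪ changeOfVariablesRel ∪ greenGens)) :=
  rfl

/-- Sanity: the crux is the implication antecedent → PlanarK0Injective. -/
example : Theses.SymplecticScissors.PlanarCompiler =
    (Theses.SymplecticScissors.RealOnePeriodRelations → Theses.SymplecticScissors.PlanarK0Injective) :=
  rfl

/-! ## §1 Lever `tame-antecedent-bootstrap`: the antecedent improves itself in dimension 1 -/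

/-- The dimension-1 move instances (1a, 1b, 2) all of whose terms are TAME representations. -/
def tameMoves : Set FormalRep :=
  (domainAddRel ∪ integrandAddRel ∪ changeOfVariablesRel) ∩ (AddSubgroup.closure tameGens : Set FormalRep)

/-- **First lemma (TameRetraction).** There is an additive endomorphism `N` of the free group which
(i) preserves values, (ii) moves a tame 1-dimensional generator only by a chain of move instances
among tame representations, (iii) sends every 1-dimensional generator into the span of tame ones (cut
at the finitely many singular points and interval ends — rule 1a; compactify unbounded ends `x = 1/s`
and flatten integrable blow-ups by Puiseux power substitutions `x = x₀ ± t^q` — rule 2; all in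
dimension 1), and (iv) carries each dimension-1 instance of 1a / 1b / 2 to a chain of instances among
tame representations and changes a Green generator only by such a chain.  Antecedent-free: a finite
statement of one-variable real semialgebraic geometry (`N := FreeAbelianGroup.lift` of a recipe on
generators; (iv) by common refinement of cut points and of Puiseux denominators). -/
def TameRetraction : Prop :=
  ∃ N : FormalRep →+ FormalRep,
    (∀ c, eval (N c) = eval c) ∧
    (∀ r : IntegralRep 1, IsTame r → N (of r) - of r ∈ AddSubgroup.closure tameMoves) ∧
    (∀ r : IntegralRep 1, N (of r) ∈ AddSubgroup.closure tameGens) ∧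
    (∀ s ∈ (domainAddRel ∪ integrandAddRel ∪ changeOfVariablesRel) ∩
        (AddSubgroup.closure dimOneGens : Set FormalRep), N s ∈ AddSubgroup.closure tameMoves) ∧
    (∀ g ∈ greenGens, N g - g ∈ AddSubgroup.closure tameMoves)

/-- The tame form of the antecedent: vanishing combinations of TAME 1-dimensional representations are
generated by move instances among tame representations and the Green generators. -/
def TameOnePeriodRelations : Prop :=
  ∀ c : FormalRep, c ∈ AddSubgroup.closure tameGens → eval c = 0 →
    c ∈ AddSubgroup.closure (tameMoves ∪ greenGens)

/-- **Bootstrap.** `TameRetraction` upgrades the antecedent (projection to the dimension-1 summand of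
the free group, then `N`). -/
def TameBootstrap : Prop :=
  TameRetraction → Theses.SymplecticScissors.RealOnePeriodRelations → TameOnePeriodRelations

/-- **Tame compiler** — what is left for the plane once the bootstrap holds: the compiler `Θ` need only
kill TAME move instances and Green generators, and the two given regions need only be normalised to
cells of tame representations. -/
def TameCompiler : Prop :=
  TameOnePeriodRelations → Theses.SymplecticScissors.PlanarK0Injective

/-- Assembly of the lever (pure logic). -/
theorem planarCompiler_of_tame (h₁ : TameRetraction) (h₂ : TameBootstrap) (h₃ : TameCompiler) :
    Theses.SymplecticScissors.PlanarCompiler :=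
  fun hR => h₃ (h₂ h₁ hR)

/-! ## §2 Lever `twist-restoring-shear`: `S ↦ S + λab` makes the Green correspondence fold-free -/

/-- The open standard triangle. -/
def openTriangle : Set (Fin 2 → ℝ) := {p | 0 < p 0 ∧ 0 < p 1 ∧ p 0 + p 1 < 1}

/-- **First lemma (FoldFreeGreenTransport).** Let `A da + B db = dS` on the open triangle with `A`, `B`
`ℚ`-semialgebraic and continuous on the closed triangle and `C¹` inside, and let `λ` exceed minus the
mixed partial `∂_b A (= ∂_a B)` everywhere inside.  Then `Ψ₁ = (a, A + λb)` and `Ψ₂ = (b, B + λa)` are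
injective on the open triangle with `det DΨ₁ = −det DΨ₂ = ∂_bA + λ > 0`, and the integrand-1
representations on the two BANDS `Ψ₁(Δ°) = {A(a,0) < v < A(a,1−a) + λ(1−a)}` and
`Ψ₂(Δ°) = {B(0,b) < w < B(1−b,b) + λ(1−b)}` differ by ONE change-of-variables instance
(`Φ = Ψ₂ ∘ Ψ₁⁻¹`, `|det Φ'| = 1`).  No subdivision of the triangle by the sign of `∂_bA` occurs. -/
def FoldFreeGreenTransport : Prop :=
  ∀ (A B S : (Fin 2 → ℝ) → ℝ) (lam : ℝ),
    IsSemialgebraicFunOn ℚ {p | 0 ≤ p 0 ∧ 0 ≤ p 1 ∧ p 0 + p 1 ≤ 1} A →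
    IsSemialgebraicFunOn ℚ {p | 0 ≤ p 0 ∧ 0 ≤ p 1 ∧ p 0 + p 1 ≤ 1} B →
    ContinuousOn A {p | 0 ≤ p 0 ∧ 0 ≤ p 1 ∧ p 0 + p 1 ≤ 1} →
    ContinuousOn B {p | 0 ≤ p 0 ∧ 0 ≤ p 1 ∧ p 0 + p 1 ≤ 1} →
    ContDiffOn ℝ 1 A openTriangle → ContDiffOn ℝ 1 B openTriangle →
    (∀ p ∈ openTriangle, HasFDerivAt S (A p • ContinuousLinearMap.proj (R := ℝ) (φ := fun _ : Fin 2 => ℝ) 0 +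
        B p • ContinuousLinearMap.proj (R := ℝ) (φ := fun _ : Fin 2 => ℝ) 1) p) →
    (∀ p ∈ openTriangle, 0 < lam + fderiv ℝ A p (Pi.single 1 1)) →
    ∀ (r r' : IntegralRep 2),
      r.domain = {q | q 0 ∈ Set.Ioo 0 1 ∧ A ![q 0, 0] < q 1 ∧ q 1 < A ![q 0, 1 - q 0] + lam * (1 - q 0)} →
      r'.domain = {q | q 0 ∈ Set.Ioo 0 1 ∧ B ![0, q 0] < q 1 ∧ q 1 < B ![1 - q 0, q 0] + lam * (1 - q 0)} →
      (∀ q ∈ r.domain, r.integrand q = 1) → (∀ q ∈ r'.domain, r'.integrand q = 1) →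
      of r - of r' ∈ changeOfVariablesRel

/-- **Band bookkeeping** (the only other planar input of the lever): a band between two tame functions
`g < h` over `(0,1)` is, in the planar set-chain group, `Θ[∫h] − Θ[∫g]` with
`Θ[∫f] = [cell of f⁺] − [cell of f⁻]` (three sign cases: cut along `y = 0` (1a) and reflect
`(x,y) ↦ (x,−y)` (rule 2)). Stated for the cells as integrand-1 representations. -/
def BandIsDifferenceOfCells : Prop :=
  ∀ (g h : ℝ → ℝ) (band hp hm gp gm : IntegralRep 2),
    IsSemialgebraicFunOn ℚ {z : Fin 1 → ℝ | z 0 ∈ Set.Ioo 0 1} (fun z => g (z 0)) →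
    IsSemialgebraicFunOn ℚ {z : Fin 1 → ℝ | z 0 ∈ Set.Ioo 0 1} (fun z => h (z 0)) →
    (∀ x ∈ Set.Ioo (0:ℝ) 1, g x < h x) →
    band.domain = {q | q 0 ∈ Set.Ioo 0 1 ∧ g (q 0) < q 1 ∧ q 1 < h (q 0)} →
    hp.domain = {q | q 0 ∈ Set.Ioo 0 1 ∧ 0 < q 1 ∧ q 1 < h (q 0)} →
    hm.domain = {q | q 0 ∈ Set.Ioo 0 1 ∧ 0 < q 1 ∧ q 1 < - h (q 0)} →
    gp.domain = {q | q 0 ∈ Set.Ioo 0 1 ∧ 0 < q 1 ∧ q 1 < g (q 0)} →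
    gm.domain = {q | q 0 ∈ Set.Ioo 0 1 ∧ 0 < q 1 ∧ q 1 < - g (q 0)} →
    (∀ q ∈ band.domain, band.integrand q = 1) → (∀ q ∈ hp.domain, hp.integrand q = 1) →
    (∀ q ∈ hm.domain, hm.integrand q = 1) → (∀ q ∈ gp.domain, gp.integrand q = 1) →
    (∀ q ∈ gm.domain, gm.integrand q = 1) →
    of band - (of hp - of hm) + (of gp - of gm) ∈ planarGroup

/-! ## §3 Lever `signed-indicator-calculus`: sets mod 1a = ℤ-valued functions mod null -/

/-- **First lemma (IndicatorKernel).** If a ℤ-combination of planar integrand-1 representations has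
indicator sum vanishing almost everywhere, it is a sum of (differences of) planar 1a instances:
the free group on planar ℚ-semialgebraic sets modulo rule 1a is the group of ℤ-valued semialgebraic
functions modulo Lebesgue-null sets (common cylindrical refinement; lower-dimensional cells `N`
satisfy `−[N] = [N] − [N] − [N] ∈ 1a`). -/
def IndicatorKernel : Prop :=
  ∀ (k : ℕ) (s : Fin k → IntegralRep 2) (n : Fin k → ℤ),
    (∀ i, ∀ p ∈ (s i).domain, (s i).integrand p = 1) →
    (∀ᵐ p ∂(volume : Measure (Fin 2 → ℝ)),
        ∑ i, (n i : ℝ) * (s i).domain.indicator (fun _ => (1 : ℝ)) p = 0) →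
    ∑ i, n i • of (s i) ∈ AddSubgroup.closure (domainAddRel ∩ (AddSubgroup.closure planarGens : Set FormalRep))

/-- **Pushforward lemma** (the only other relation of the model): for a `ℚ`-semialgebraic map `Φ`
injective and differentiable with `|det Φ'| = 1` on a planar `ℚ`-semialgebraic set `σ` of finite
area, `[σ] − [Φ σ]` lies in the planar group — verbatim one rule-2 instance; recorded to fix the shape
in which the compiler's 1b step is used: `χ_{f+g} = χ_f + (τ_f)_* χ_g` a.e. for the ORIENTED fibre
indicators `χ_f = 1_{0<y<f} − 1_{f<y<0}` and the shear `τ_f (x,y) = (x, y + f x)`, with no case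
distinction on the signs of `f`, `g`, `f + g`. -/
def OrientedStacking : Prop :=
  ∀ (a b : ℝ) (f g : ℝ → ℝ) (r r₁ r₂ : IntegralRep 1)
    (cp cm c₁p c₁m c₂p c₂m : IntegralRep 2),
    a < b →
    r.domain = {z | z 0 ∈ Set.Ioo a b} → r₁.domain = {z | z 0 ∈ Set.Ioo a b} →
    r₂.domain = {z | z 0 ∈ Set.Ioo a b} →
    (∀ z ∈ r₁.domain, r₁.integrand z = f (z 0)) → (∀ z ∈ r₂.domain, r₂.integrand z = g (z 0)) →
    (∀ z ∈ r.domain, r.integrand z = f (z 0) + g (z 0)) →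
    cp.domain = {q | q 0 ∈ Set.Ioo a b ∧ 0 < q 1 ∧ q 1 < f (q 0) + g (q 0)} →
    cm.domain = {q | q 0 ∈ Set.Ioo a b ∧ 0 < q 1 ∧ q 1 < -(f (q 0) + g (q 0))} →
    c₁p.domain = {q | q 0 ∈ Set.Ioo a b ∧ 0 < q 1 ∧ q 1 < f (q 0)} →
    c₁m.domain = {q | q 0 ∈ Set.Ioo a b ∧ 0 < q 1 ∧ q 1 < - f (q 0)} →
    c₂p.domain = {q | q 0 ∈ Set.Ioo a b ∧ 0 < q 1 ∧ q 1 < g (q 0)} →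
    c₂m.domain = {q | q 0 ∈ Set.Ioo a b ∧ 0 < q 1 ∧ q 1 < - g (q 0)} →
    (∀ q ∈ cp.domain, cp.integrand q = 1) → (∀ q ∈ cm.domain, cm.integrand q = 1) →
    (∀ q ∈ c₁p.domain, c₁p.integrand q = 1) → (∀ q ∈ c₁m.domain, c₁m.integrand q = 1) →
    (∀ q ∈ c₂p.domain, c₂p.integrand q = 1) → (∀ q ∈ c₂m.domain, c₂m.integrand q = 1) →
    (of cp - of cm) - (of c₁p - of c₁m) - (of c₂p - of c₂m) ∈ planarGroup

end Summit.KontsevichZagierPeriods.KontsevichZagierPeriods.Cruxes.PlanarCompiler.Ideator2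

/-! ## §3' The pointwise identity behind `oriented-fibre-indicators` (PROVED): oriented interval
indicators are additive with NO sign hypothesis — `χ_{F+G}(y) = χ_F(y) + χ_G(y − F)` off the three
endpoints `0, F, F+G` (a null set of `y` for each fibre). -/

namespace Summit.KontsevichZagierPeriods.KontsevichZagierPeriods.Cruxes.PlanarCompiler.Ideator2

/-- The oriented indicator of the interval from `0` to `F`, evaluated at `y`. -/
def chi (F y : ℝ) : ℤ := if 0 < y ∧ y < F then 1 else if F < y ∧ y < 0 then -1 else 0

/-- **Oriented additivity** (all sign patterns of `F`, `G`, `F + G` at once). -/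
theorem chi_add (F G y : ℝ) (h0 : y ≠ 0) (hF : y ≠ F) (hFG : y ≠ F + G) :
    chi (F + G) y = chi F y + chi G (y - F) := by
  rcases lt_or_gt_of_ne h0 with h0 | h0 <;> rcases lt_or_gt_of_ne hF with hF | hF <;>
    rcases lt_or_gt_of_ne hFG with hFG | hFG <;>
    simp only [chi, sub_pos, sub_lt_iff_lt_add', lt_sub_iff_add_lt', h0, hF, hFG,
      not_lt.mpr (le_of_lt h0), not_lt.mpr (le_of_lt hF),
      not_lt.mpr (le_of_lt hFG), and_true, true_and, and_false, false_and, if_true,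
      if_false] <;>
    first | rfl | linarith | simp [hF, le_of_lt hF]

end Summit.KontsevichZagierPeriods.KontsevichZagierPeriods.Cruxes.PlanarCompiler.Ideator2
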